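import Mathlib.Analysis.Calculus.Taylor
import Mathlib.Analysis.Calculus.ContDiff.Basic
import Mathlib.Analysis.Convex.Function
import Mathlib.Analysis.InnerProductSpace.PiL2
import Mathlib.Analysis.Normed.Group.Bounded
import Mathlib.MeasureTheory.Function.LocallyIntegrable
import Mathlib.MeasureTheory.Group.Integral
import Mathlib.MeasureTheory.Integral.DominatedConvergence
import Mathlib.MeasureTheory.Measure.Haar.InnerProductSpace

/-!
# Stub `stub_semiconvexLaplacian` of line `Sketch` for crux `YamabePinchedEinsteinBulk`
(item stmt-SmoothPoincare4-7996, routes `InformationMetricHadamard` / `EinsteinBulk`)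

**The flat model lemma of card `semiconcave-visual-energy`: a semiconvex function has
distributional Laplacian bounded below.**  On `ℝ⁴ = EuclideanSpace ℝ (Fin 4)`: if `u` is
continuous and `u + (C/2)‖·‖²` is convex, then for every `φ ≥ 0` of class `C²` with compact
support, `∫ u Δφ ≥ -4C ∫ φ`, where `Δφ(x) = ∑ᵢ D²φ(x)(eᵢ, eᵢ)` is written with
`iteratedFDeriv ℝ 2 φ x ![eᵢ, eᵢ]`, `eᵢ = EuclideanSpace.single i 1`.

Proof (difference quotients, no distributions): for a unit vector `v` and `h > 0`,
* discrete integration by parts (translation invariance of Lebesgue measure):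
  `∫ u(x) (φ(x+hv) + φ(x-hv) - 2φ(x)) dx = ∫ (u(x-hv) + u(x+hv) - 2u(x)) φ(x) dx`;
* convexity of `u + (C/2)‖·‖²` at the midpoint `x` of `x ± hv` and the parallelogram law give
  `u(x+hv) + u(x-hv) - 2u(x) ≥ -C h²`, whence `∫ u · (second difference quotient of φ) ≥ -C ∫ φ`;
* `h → 0⁺`: the second difference quotient of `φ` converges pointwise to `D²φ(x)(v, v)`
  (Taylor–Lagrange along the line `t ↦ φ(x + t v)`), boundedly and with support in a fixed compact
  set, so dominated convergence passes the inequality to the limit;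
* summing over the four coordinate directions gives the constant `4C`.

Everything is proved (kind = proof); Mathlib only.
-/

noncomputable section

-- the prescribed namespace `Summit.<P>.<Sub>.…` duplicates `SmoothPoincare4` (P = Sub)
set_option linter.dupNamespace false

open scoped Topology
open Set Filter MeasureTheory Metric

namespace Summit.SmoothPoincare4.SmoothPoincare4.Cruxes.YamabePinchedEinsteinBulk.Sketch

/-! ## One-dimensional second differences (Taylor–Lagrange) -/

/-- **Symmetric second difference, Lagrange form.** For `g ∈ C²(ℝ)` and `h > 0` there are
`s₁, s₂ ∈ (-h, h)` with `g(h) + g(-h) - 2 g(0) = (g''(s₁) + g''(s₂))/2 · h²`. [folklore] -/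
theorem secondDiff_eq_lagrange {g : ℝ → ℝ} (hg : ContDiff ℝ 2 g) {h : ℝ} (hh : 0 < h) :
    ∃ s₁ ∈ Ioo (-h) h, ∃ s₂ ∈ Ioo (-h) h,
      g h + g (-h) - 2 * g 0 = (iteratedDeriv 2 g s₁ + iteratedDeriv 2 g s₂) / 2 * h ^ 2 := by
  -- Taylor–Lagrange of order 1 at `0`, evaluated at `t = h` and `t = -h`
  have key : ∀ t : ℝ, t ≠ 0 → ∃ s ∈ uIoo (0 : ℝ) t,
      g t - (g 0 + deriv g 0 * t) = iteratedDeriv 2 g s * t ^ 2 / 2 := by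
    intro t ht
    obtain ⟨s, hs, hst⟩ :=
      taylor_mean_remainder_lagrange_iteratedDeriv (n := 1) (Ne.symm ht) hg.contDiffOn
    refine ⟨s, hs, ?_⟩
    have hU : UniqueDiffWithinAt ℝ (uIcc 0 t) 0 :=
      uniqueDiffOn_Icc (inf_lt_sup.2 (Ne.symm ht)) 0 left_mem_uIcc
    have hT : taylorWithinEval g 1 (uIcc 0 t) 0 t = g 0 + deriv g 0 * t := by
      rw [taylor_within_apply]
      simp [Finset.sum_range_succ,
        ((hg.differentiable (by norm_num)).differentiableAt).derivWithin hU]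
      ring
    rw [← hT, hst]
    simp [Nat.factorial]
  obtain ⟨s₁, hs₁, h₁⟩ := key h hh.ne'
  obtain ⟨s₂, hs₂, h₂⟩ := key (-h) (neg_ne_zero.2 hh.ne')
  refine ⟨s₁, ?_, s₂, ?_, ?_⟩
  · rw [uIoo_of_lt hh] at hs₁
    exact ⟨by linarith [hs₁.1], hs₁.2⟩
  · rw [uIoo_of_gt (neg_lt_zero.2 hh)] at hs₂
    exact ⟨hs₂.1, by linarith [hs₂.2]⟩
  · linear_combination h₁ + h₂

/-- **Second difference estimate.** If `|g'' - L| ≤ S` on `(-h, h)` then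
`|g(h) + g(-h) - 2g(0) - L h²| ≤ S h²`. [folklore] -/
theorem abs_secondDiff_sub_le {g : ℝ → ℝ} (hg : ContDiff ℝ 2 g) {h L S : ℝ} (hh : 0 < h)
    (hS : ∀ s ∈ Ioo (-h) h, |iteratedDeriv 2 g s - L| ≤ S) :
    |g h + g (-h) - 2 * g 0 - L * h ^ 2| ≤ S * h ^ 2 := by
  obtain ⟨s₁, hs₁, s₂, hs₂, heq⟩ := secondDiff_eq_lagrange hg hh
  have : g h + g (-h) - 2 * g 0 - L * h ^ 2 =
      ((iteratedDeriv 2 g s₁ - L) + (iteratedDeriv 2 g s₂ - L)) / 2 * h ^ 2 := by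
    rw [heq]; ring
  rw [this, abs_mul, abs_div, abs_two, abs_of_nonneg (by positivity : (0 : ℝ) ≤ h ^ 2)]
  have := abs_add_le (iteratedDeriv 2 g s₁ - L) (iteratedDeriv 2 g s₂ - L)
  nlinarith [sq_nonneg h, hS s₁ hs₁, hS s₂ hs₂]

/-! ## Second derivatives along a line -/

section Line

variable {E : Type*} [NormedAddCommGroup E] [NormedSpace ℝ E]

/-- The restriction of a `Cⁿ` function to a line is `Cⁿ`. [folklore] -/
theorem contDiff_line {φ : E → ℝ} {n : WithTop ℕ∞} (hφ : ContDiff ℝ n φ) (x v : E) :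
    ContDiff ℝ n fun t : ℝ => φ (x + t • v) :=
  hφ.comp (contDiff_const.add (contDiff_id.smul contDiff_const))

/-- The second derivative of `t ↦ φ(x + t v)` is `D²φ(x + t v)(v, v)`. [folklore] -/
theorem iteratedDeriv_two_line {φ : E → ℝ} (hφ : ContDiff ℝ 2 φ) (x v : E) (s : ℝ) :
    iteratedDeriv 2 (fun t : ℝ => φ (x + t • v)) s =
      iteratedFDeriv ℝ 2 φ (x + s • v) ![v, v] := by
  have h1 : (fun t : ℝ => φ (x + t • v)) =
      (fun y : E => φ (x + y)) ∘ (ContinuousLinearMap.toSpanSingleton ℝ v) := by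
    ext t; simp [ContinuousLinearMap.toSpanSingleton_apply]
  have h2 : ContDiff ℝ 2 fun y : E => φ (x + y) := hφ.comp (contDiff_const.add contDiff_id)
  rw [iteratedDeriv_eq_iteratedFDeriv, h1,
    ContinuousLinearMap.iteratedFDeriv_comp_right _ h2 _ le_rfl,
    ContinuousMultilinearMap.compContinuousLinearMap_apply, iteratedFDeriv_comp_add_left]
  simp only [ContinuousLinearMap.toSpanSingleton_apply, one_smul]
  congr 1
  ext i
  fin_cases i <;> rfl

/-- `y ↦ D²φ(y)(v, v)` is continuous for `φ ∈ C²`. [folklore] -/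
theorem continuous_iteratedFDeriv_two_apply {φ : E → ℝ} (hφ : ContDiff ℝ 2 φ) (v : E) :
    Continuous fun y => iteratedFDeriv ℝ 2 φ y ![v, v] :=
  (continuous_eval_const (![v, v] : Fin 2 → E)).comp (hφ.continuous_iteratedFDeriv le_rfl)

/-- `y ↦ D²φ(y)(v, v)` has compact support if `φ` has. [folklore] -/
theorem hasCompactSupport_iteratedFDeriv_two_apply {φ : E → ℝ} (hφc : HasCompactSupport φ)
    (v : E) : HasCompactSupport fun y => iteratedFDeriv ℝ 2 φ y ![v, v] :=
  (hφc.iteratedFDeriv (𝕜 := ℝ) 2).comp_left (g := fun T : E [×2]→L[ℝ] ℝ => T ![v, v]) rfl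

/-- **Pointwise limit of the symmetric second difference quotient**:
`(φ(x+hv) + φ(x-hv) - 2φ(x))/h² → D²φ(x)(v,v)` as `h → 0⁺`, for `φ ∈ C²`. [folklore] -/
theorem tendsto_secondDiffQuot {φ : E → ℝ} (hφ : ContDiff ℝ 2 φ) (x v : E) :
    Tendsto (fun h : ℝ => (φ (x + h • v) + φ (x - h • v) - 2 * φ x) / h ^ 2) (𝓝[>] 0)
      (𝓝 (iteratedFDeriv ℝ 2 φ x ![v, v])) := by
  set L : ℝ := iteratedFDeriv ℝ 2 φ x ![v, v]
  have hcont : Continuous fun s : ℝ => iteratedFDeriv ℝ 2 φ (x + s • v) ![v, v] :=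
    (continuous_iteratedFDeriv_two_apply hφ v).comp
      (continuous_const.add (continuous_id.smul continuous_const))
  rw [Metric.tendsto_nhdsWithin_nhds]
  intro ε hε
  obtain ⟨δ, hδ, hδε⟩ := Metric.continuous_iff.1 hcont 0 (ε / 2) (half_pos hε)
  refine ⟨δ, hδ, fun h hh hhδ => ?_⟩
  have hh0 : 0 < h := hh
  have hhδ' : h < δ := by simpa [Real.dist_eq, abs_of_pos hh0] using hhδ
  have hS : ∀ s ∈ Ioo (-h) h,
      |iteratedDeriv 2 (fun t : ℝ => φ (x + t • v)) s - L| ≤ ε / 2 := by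
    intro s hs
    rw [iteratedDeriv_two_line hφ x v]
    have := hδε s (by rw [Real.dist_eq, sub_zero]; exact (abs_lt.2 hs).trans hhδ')
    simp only [zero_smul, add_zero, Real.dist_eq] at this
    exact this.le
  have key : |φ (x + h • v) + φ (x - h • v) - 2 * φ x - L * h ^ 2| ≤ ε / 2 * h ^ 2 := by
    simpa [neg_smul, sub_eq_add_neg] using abs_secondDiff_sub_le (contDiff_line hφ x v) hh0 hS
  have hh2 : 0 < h ^ 2 := by positivity
  rw [Real.dist_eq, show (φ (x + h • v) + φ (x - h • v) - 2 * φ x) / h ^ 2 - L =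
      (φ (x + h • v) + φ (x - h • v) - 2 * φ x - L * h ^ 2) / h ^ 2 by field_simp,
    abs_div, abs_of_pos hh2, div_lt_iff₀ hh2]
  nlinarith [mul_pos hε hh2]

/-- **Uniform bound on the symmetric second difference**:
`|φ(x+hv) + φ(x-hv) - 2φ(x)| ≤ M h²` whenever `|D²φ(·)(v,v)| ≤ M` everywhere. [folklore] -/
theorem abs_secondDiff_le {φ : E → ℝ} (hφ : ContDiff ℝ 2 φ) (x v : E) {M : ℝ}
    (hM : ∀ y, |iteratedFDeriv ℝ 2 φ y ![v, v]| ≤ M) {h : ℝ} (hh : 0 < h) :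
    |φ (x + h • v) + φ (x - h • v) - 2 * φ x| ≤ M * h ^ 2 := by
  have hg : ContDiff ℝ 2 (fun t : ℝ => φ (x + t • v)) := contDiff_line hφ x v
  have hS : ∀ s ∈ Ioo (-h) h, |iteratedDeriv 2 (fun t : ℝ => φ (x + t • v)) s - 0| ≤ M := by
    intro s _
    rw [sub_zero, iteratedDeriv_two_line hφ x v]
    exact hM _
  have key := abs_secondDiff_sub_le hg hh hS
  simpa [neg_smul, sub_eq_add_neg] using key

end Line

/-! ## Integrals: translation, convexity, dominated convergence -/

section Translation

variable {E : Type*} [NormedAddCommGroup E] [MeasurableSpace E] [BorelSpace E]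
  {μ : Measure E} [μ.IsAddHaarMeasure]

/-- A continuous function times a translate of a continuous compactly supported function is
integrable. [folklore] -/
theorem integrable_mul_comp_add {u φ : E → ℝ} (hu : Continuous u) (hφ : Continuous φ)
    (hφc : HasCompactSupport φ) (w : E) : Integrable (fun x => u x * φ (x + w)) μ :=
  (hu.mul (hφ.comp (continuous_add_const w))).integrable_of_hasCompactSupport
    (hφc.comp_homeomorph (Homeomorph.addRight w)).mul_left

/-- A translate of a continuous function times a continuous compactly supported function is
integrable. [folklore] -/
theorem integrable_comp_add_mul {u φ : E → ℝ} (hu : Continuous u) (hφ : Continuous φ)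
    (hφc : HasCompactSupport φ) (w : E) : Integrable (fun x => u (x + w) * φ x) μ :=
  ((hu.comp (continuous_add_const w)).mul hφ).integrable_of_hasCompactSupport hφc.mul_left

/-- **Discrete integration by parts** (translation invariance of Haar measure):
`∫ u(x) φ(x + w) dx = ∫ u(x - w) φ(x) dx`. [folklore] -/
theorem integral_mul_comp_add (u φ : E → ℝ) (w : E) :
    ∫ x, u x * φ (x + w) ∂μ = ∫ x, u (x - w) * φ x ∂μ := by
  rw [← integral_add_right_eq_self (fun x => u (x - w) * φ x) w]
  simp

end Translation

section Convergence

variable {E : Type*} [NormedAddCommGroup E] [NormedSpace ℝ E] [MeasurableSpace E] [BorelSpace E]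
  {μ : Measure E} [μ.IsAddHaarMeasure]

/-- A continuous function times `D²φ(·)(v, v)` is integrable for `φ ∈ C²_c`. [folklore] -/
theorem integrable_mul_iteratedFDeriv_two_apply {u φ : E → ℝ} (hu : Continuous u)
    (hφ : ContDiff ℝ 2 φ) (hφc : HasCompactSupport φ) (v : E) :
    Integrable (fun x => u x * iteratedFDeriv ℝ 2 φ x ![v, v]) μ :=
  (hu.mul (continuous_iteratedFDeriv_two_apply hφ v)).integrable_of_hasCompactSupport
    (hasCompactSupport_iteratedFDeriv_two_apply hφc v).mul_left

variable [FiniteDimensional ℝ E]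

/-- **Dominated convergence for the second difference quotients**:
`∫ u · (φ(·+hv) + φ(·-hv) - 2φ)/h² → ∫ u · D²φ(·)(v,v)` as `h → 0⁺`. [folklore] -/
theorem tendsto_integral_mul_secondDiffQuot {u φ : E → ℝ} (hu : Continuous u)
    (hφ : ContDiff ℝ 2 φ) (hφc : HasCompactSupport φ) (v : E) :
    Tendsto (fun h : ℝ => ∫ x, u x * ((φ (x + h • v) + φ (x - h • v) - 2 * φ x) / h ^ 2) ∂μ)
      (𝓝[>] 0) (𝓝 (∫ x, u x * iteratedFDeriv ℝ 2 φ x ![v, v] ∂μ)) := by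
  have hφ' : Continuous φ := hφ.continuous
  let K := cthickening ‖v‖ (tsupport φ)
  have hK : IsCompact K := hφc.cthickening
  obtain ⟨Mu, hMu⟩ : ∃ M, ∀ x ∈ K, ‖u x‖ ≤ M := hK.exists_bound_of_continuousOn hu.continuousOn
  obtain ⟨Mφ, hMφ⟩ : ∃ M, ∀ y, ‖iteratedFDeriv ℝ 2 φ y ![v, v]‖ ≤ M :=
    (continuous_iteratedFDeriv_two_apply hφ v).bounded_above_of_compact_support
      (hasCompactSupport_iteratedFDeriv_two_apply hφc v)
  have hMφ' : ∀ y, |iteratedFDeriv ℝ 2 φ y ![v, v]| ≤ Mφ := fun y => by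
    simpa [Real.norm_eq_abs] using hMφ y
  apply tendsto_integral_filter_of_dominated_convergence (K.indicator fun _ => Mu * Mφ)
  · filter_upwards with h
    exact (Continuous.aestronglyMeasurable (by fun_prop))
  · filter_upwards [Ioc_mem_nhdsGT zero_lt_one] with h hh
    have h_pos : 0 < h := hh.1
    have hh2 : 0 < h ^ 2 := by positivity
    filter_upwards with x
    by_cases hx : x ∈ K
    · rw [indicator_of_mem hx, norm_mul, Real.norm_eq_abs, Real.norm_eq_abs, abs_div,
        abs_of_pos hh2, ← mul_div_assoc, div_le_iff₀ hh2]
      have h1 : |u x| ≤ Mu := by simpa [Real.norm_eq_abs] using hMu x hx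
      have h2 := abs_secondDiff_le hφ x v hMφ' h_pos
      have hMu0 : 0 ≤ Mu := (abs_nonneg _).trans h1
      calc |u x| * |φ (x + h • v) + φ (x - h • v) - 2 * φ x| ≤ Mu * (Mφ * h ^ 2) :=
            mul_le_mul h1 h2 (abs_nonneg _) hMu0
        _ = Mu * Mφ * h ^ 2 := by ring
    · have hz : ∀ y, dist x y ≤ ‖v‖ → φ y = 0 := fun y hxy => by
        by_contra hy
        exact hx (mem_cthickening_of_dist_le _ _ _ _ (subset_tsupport _ hy) hxy)
      have hv' : ‖h • v‖ ≤ ‖v‖ := by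
        rw [norm_smul, Real.norm_eq_abs, abs_of_nonneg h_pos.le]
        exact mul_le_of_le_one_left (norm_nonneg v) hh.2
      rw [hz x (by simp), hz (x + h • v) (by rwa [dist_eq_norm, sub_add_cancel_left, norm_neg]),
        hz (x - h • v) (by rwa [dist_eq_norm, sub_sub_cancel])]
      simp [indicator_of_notMem hx]
  · rw [integrable_indicator_iff hK.measurableSet]
    exact integrableOn_const (hK.measure_lt_top.ne)
  · filter_upwards with x
    exact (tendsto_secondDiffQuot hφ x v).const_mul (u x)

end Convergence

section Convex

variable {F : Type*} [NormedAddCommGroup F] [InnerProductSpace ℝ F]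

/-- **Semiconvexity bounds second differences from below**: if `u + (C/2)‖·‖²` is convex then
`u(x + w) + u(x - w) - 2u(x) ≥ -C‖w‖²` (parallelogram law). [folklore] -/
theorem secondDiff_ge_of_convexOn {u : F → ℝ} {C : ℝ}
    (hconv : ConvexOn ℝ univ fun x => u x + C / 2 * ‖x‖ ^ 2) (x w : F) :
    -(C * ‖w‖ ^ 2) ≤ u (x + w) + u (x - w) - 2 * u x := by
  have key := hconv.2 (mem_univ (x + w)) (mem_univ (x - w)) (by norm_num : (0 : ℝ) ≤ 1 / 2)
    (by norm_num : (0 : ℝ) ≤ 1 / 2) (by norm_num)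
  have hmid : (1 / 2 : ℝ) • (x + w) + (1 / 2 : ℝ) • (x - w) = x := by
    rw [smul_add, smul_sub, add_add_sub_cancel, ← add_smul]
    norm_num
  rw [hmid] at key
  simp only [smul_eq_mul] at key
  have hpar : C / 2 * ‖x + w‖ ^ 2 + C / 2 * ‖x - w‖ ^ 2 = C * ‖x‖ ^ 2 + C * ‖w‖ ^ 2 := by
    rw [← mul_add, parallelogram_law_with_norm ℝ x w]; ring
  linarith

variable [MeasurableSpace F] [BorelSpace F] {ν : Measure F} [ν.IsAddHaarMeasure]

/-- **The inequality at positive step `h`**: for a unit vector `v`,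
`-C ∫ φ ≤ ∫ u · (φ(·+hv) + φ(·-hv) - 2φ)/h²`. [folklore] -/
theorem integral_mul_secondDiffQuot_ge {u φ : F → ℝ} {C : ℝ}
    (hconv : ConvexOn ℝ univ fun x => u x + C / 2 * ‖x‖ ^ 2) (hu : Continuous u)
    (hφ : Continuous φ) (hφ0 : ∀ x, 0 ≤ φ x) (hφc : HasCompactSupport φ) {v : F} (hv : ‖v‖ = 1)
    {h : ℝ} (hh : 0 < h) :
    -C * ∫ x, φ x ∂ν ≤
      ∫ x, u x * ((φ (x + h • v) + φ (x - h • v) - 2 * φ x) / h ^ 2) ∂ν := by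
  have hh2 : 0 < h ^ 2 := by positivity
  -- pointwise lower bound from semiconvexity
  have hsd : ∀ x, -(C * h ^ 2) * φ x ≤ (u (x - h • v) + u (x + h • v) - 2 * u x) * φ x := by
    intro x
    refine mul_le_mul_of_nonneg_right ?_ (hφ0 x)
    have := secondDiff_ge_of_convexOn hconv x (h • v)
    rw [norm_smul, hv, mul_one, Real.norm_eq_abs, sq_abs] at this
    linarith
  -- integrability
  have iφ : Integrable φ ν := hφ.integrable_of_hasCompactSupport hφc
  have i0 : Integrable (fun x => u x * φ x) ν :=
    (hu.mul hφ).integrable_of_hasCompactSupport hφc.mul_left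
  have i02 : Integrable (fun x => 2 * (u x * φ x)) ν := i0.const_mul 2
  have ip : Integrable (fun x => u x * φ (x + h • v)) ν := integrable_mul_comp_add hu hφ hφc _
  have im : Integrable (fun x => u x * φ (x - h • v)) ν := by
    simpa [sub_eq_add_neg] using integrable_mul_comp_add (μ := ν) hu hφ hφc (-(h • v))
  have ipm : Integrable (fun x => u x * φ (x + h • v) + u x * φ (x - h • v)) ν := ip.add im
  have ip' : Integrable (fun x => u (x + h • v) * φ x) ν := integrable_comp_add_mul hu hφ hφc _
  have im' : Integrable (fun x => u (x - h • v) * φ x) ν := by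
    simpa [sub_eq_add_neg] using integrable_comp_add_mul (μ := ν) hu hφ hφc (-(h • v))
  have imp' : Integrable (fun x => u (x - h • v) * φ x + u (x + h • v) * φ x) ν := im'.add ip'
  have irhs : Integrable (fun x => (u (x - h • v) + u (x + h • v) - 2 * u x) * φ x) ν :=
    (imp'.sub i02).congr (ae_of_all _ fun x => by simp only [Pi.sub_apply]; ring)
  -- translation
  have ep : ∫ x, u x * φ (x + h • v) ∂ν = ∫ x, u (x - h • v) * φ x ∂ν :=
    integral_mul_comp_add u φ (h • v)
  have em : ∫ x, u x * φ (x - h • v) ∂ν = ∫ x, u (x + h • v) * φ x ∂ν := by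
    have := integral_mul_comp_add (μ := ν) u φ (-(h • v))
    simpa [sub_eq_add_neg] using this
  -- the computation
  have lhs : ∫ x, u x * ((φ (x + h • v) + φ (x - h • v) - 2 * φ x) / h ^ 2) ∂ν =
      (h ^ 2)⁻¹ * ∫ x, (u (x - h • v) + u (x + h • v) - 2 * u x) * φ x ∂ν := by
    have e1 : ∀ x, u x * ((φ (x + h • v) + φ (x - h • v) - 2 * φ x) / h ^ 2) =
        (h ^ 2)⁻¹ * (u x * φ (x + h • v) + u x * φ (x - h • v) - 2 * (u x * φ x)) := by
      intro x; field_simp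
    have e2 : ∀ x, (u (x - h • v) + u (x + h • v) - 2 * u x) * φ x =
        u (x - h • v) * φ x + u (x + h • v) * φ x - 2 * (u x * φ x) := by
      intro x; ring
    simp_rw [e1, e2]
    rw [integral_const_mul, integral_sub ipm i02, integral_add ip im, integral_sub imp' i02,
      integral_add im' ip', ep, em]
  rw [lhs]
  calc -C * ∫ x, φ x ∂ν = (h ^ 2)⁻¹ * ∫ x, -(C * h ^ 2) * φ x ∂ν := by
        rw [integral_const_mul]; field_simp
    _ ≤ (h ^ 2)⁻¹ * ∫ x, (u (x - h • v) + u (x + h • v) - 2 * u x) * φ x ∂ν :=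
        mul_le_mul_of_nonneg_left (integral_mono (iφ.const_mul _) irhs hsd)
          (inv_nonneg.2 hh2.le)

variable [FiniteDimensional ℝ F]

/-- **The directional inequality**: for a unit vector `v`, `-C ∫ φ ≤ ∫ u · D²φ(·)(v, v)`.
[folklore] -/
theorem integral_mul_iteratedFDeriv_two_ge {u φ : F → ℝ} {C : ℝ}
    (hconv : ConvexOn ℝ univ fun x => u x + C / 2 * ‖x‖ ^ 2) (hu : Continuous u)
    (hφ : ContDiff ℝ 2 φ) (hφ0 : ∀ x, 0 ≤ φ x) (hφc : HasCompactSupport φ) {v : F}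
    (hv : ‖v‖ = 1) :
    -C * ∫ x, φ x ∂ν ≤ ∫ x, u x * iteratedFDeriv ℝ 2 φ x ![v, v] ∂ν :=
  ge_of_tendsto (tendsto_integral_mul_secondDiffQuot hu hφ hφc v) (by
    filter_upwards [self_mem_nhdsWithin] with h hh
    exact integral_mul_secondDiffQuot_ge hconv hu hφ.continuous hφ0 hφc hv hh)

end Convex

/-! ## The registered stub -/

/-- **Registered stub `stub_semiconvexLaplacian` of line `Sketch`** (card
`semiconcave-visual-energy`, flat model on `ℝ⁴`): if `u` is continuous and `u + (C/2)‖·‖²` is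
convex, then `∫ u Δφ ≥ -4C ∫ φ` for every `φ ≥ 0` of class `C²` with compact support, with
`Δφ = ∑ᵢ D²φ(eᵢ, eᵢ)` over the standard basis of `EuclideanSpace ℝ (Fin 4)` (`Δ‖x‖² = 8`,
whence `4C = (C/2)·8`). [folklore] -/
theorem stub_semiconvexLaplacian :
    ∀ (u φ : EuclideanSpace ℝ (Fin 4) → ℝ) (C : ℝ),
      ConvexOn ℝ Set.univ (fun x => u x + C / 2 * ‖x‖ ^ 2) → Continuous u →
      ContDiff ℝ 2 φ → (∀ x, 0 ≤ φ x) → HasCompactSupport φ →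
      -(4 * C) * ∫ x, φ x ≤
        ∫ x, u x * ∑ i : Fin 4, iteratedFDeriv ℝ 2 φ x
          ![EuclideanSpace.single i (1 : ℝ), EuclideanSpace.single i (1 : ℝ)] := by
  intro u φ C hconv hu hφ hφ0 hφc
  have key : ∀ i : Fin 4, -C * ∫ x, φ x ≤ ∫ x, u x * iteratedFDeriv ℝ 2 φ x
      ![EuclideanSpace.single i (1 : ℝ), EuclideanSpace.single i (1 : ℝ)] := fun i =>
    integral_mul_iteratedFDeriv_two_ge hconv hu hφ hφ0 hφc (by simp)
  have hint : ∀ i : Fin 4, Integrable (fun x => u x * iteratedFDeriv ℝ 2 φ x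
      ![EuclideanSpace.single i (1 : ℝ), EuclideanSpace.single i (1 : ℝ)]) := fun i =>
    integrable_mul_iteratedFDeriv_two_apply hu hφ hφc _
  calc -(4 * C) * ∫ x, φ x = ∑ i : Fin 4, -C * ∫ x, φ x := by simp; ring
    _ ≤ ∑ i : Fin 4, ∫ x, u x * iteratedFDeriv ℝ 2 φ x
          ![EuclideanSpace.single i (1 : ℝ), EuclideanSpace.single i (1 : ℝ)] :=
        Finset.sum_le_sum fun i _ => key i
    _ = ∫ x, ∑ i : Fin 4, u x * iteratedFDeriv ℝ 2 φ x
          ![EuclideanSpace.single i (1 : ℝ), EuclideanSpace.single i (1 : ℝ)] :=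
        (integral_finsetSum _ fun i _ => hint i).symm
    _ = ∫ x, u x * ∑ i : Fin 4, iteratedFDeriv ℝ 2 φ x
          ![EuclideanSpace.single i (1 : ℝ), EuclideanSpace.single i (1 : ℝ)] := by
        simp_rw [Finset.mul_sum]

end Summit.SmoothPoincare4.SmoothPoincare4.Cruxes.YamabePinchedEinsteinBulk.Sketch

end
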